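import Literature.MathematicalPhysics.QuantumLattice.HeisenbergOrderNeelInfrared
import Literature.MathematicalPhysics.QuantumLattice.HeisenbergOrderNeelAssembly
import Literature.MathematicalPhysics.QuantumLattice.HeisenbergOrderDLSGaussianDomination
import HarnessLib

/-!
# Kennedy–Lieb–Shastry / Dyson–Lieb–Simon: ground-state Gaussian domination for the antiferromagnet

Trunk T-QLATTICE; sibling proof file of `HeisenbergOrder.lean` / `HeisenbergOrderNeelInfrared.lean`
(named fact `kennedy_lieb_shastry_ground`, item
`provefact-Literature.MathematicalPhysics.QuantumLa-0a1fdca558`). No statement of the tree is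
changed and no named fact is introduced. This file proves **ground-state Gaussian domination**
`E₀(H) ≤ E₀(H(h))` (Kennedy–Lieb–Shastry, J. Stat. Phys. 53 (1988) 1019–1030, eq. (18)) for the
Heisenberg antiferromagnet `H = Σ_{⟨xy⟩} 𝐒_x·𝐒_y` on the even tori of side `L ≥ 4` and the
staggered field Hamiltonian `heisFieldHamiltonian` of `HeisenbergOrderNeelInfrared.lean`, by the
route of the source (pp. 1027–1029, eqs. (15)–(25)) exactly as the tree does for the XY model in
`XYOrderReflection.lean` / `XYOrderGDProofs.lean`, reusing their abstract reflection-positivity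
core (`Matrix.kls_groundEnergy_reflection`), the geometry of the pair of reflection planes and the
counting step of the descent (`badBondCount_reflect`), and reusing from the positive-temperature
sibling `HeisenbergOrderDLSGaussianDomination.lean` the rotated antiferromagnetic field Hamiltonian
`dlsField L n g = xyRealFieldHamiltonian L n g - Σ_{⟨xy⟩} S³_xS³_y` (KLS eqs. (15)–(17) with the
field on the first component: real matrices `T¹ = S¹`, `T² = iS²`, `T³ = S³`, only the
field-carrying component completed to a square) together with its Kronecker form
`dlsField_eq_submatrix` (eq. (21): `(A - Z) ⊗ 1 + 1 ⊗ (B - Z) - Σᵢ Mᵢ ⊗ Nᵢ`, three real cross terms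
per crossing bond) and the reality of its blocks:

* the sublattice rotation by `π` about the `2`-axis on the odd sublattice (eqs. (15)–(16)), which
  conjugates `heisFieldHamiltonian L n h` (staggered field, original frame) into `dlsField L n h`
  (`groundEnergy_heisFieldHamiltonian_eq`);
* `heis_groundEnergy_reflect_le`: `½E(h^L) + ½E(h^R) ≤ E(h)`; the descent on the number of bad
  bonds (`heis_gaussianDomination_ground`);
* the corollaries: the `T = 0` infrared bound (A) for all `d ≥ 1`, all spins, all even sides
  `2k ≥ 4` (`heis_infraredBound`), and **`kennedy_lieb_shastry_ground_of_riemannSum_three`**: the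
  fact `kennedy_lieb_shastry_ground` follows from the single numerical input
  `limsup_L R_L(3) < 1/√6` on the punctured Riemann sums of the KLS integrand in `d = 3`
  (KLS p. 1022: the integral is `0.35`).

## References

* [KLS1988JSP] T. Kennedy, E. H. Lieb, B. S. Shastry, J. Stat. Phys. 53 (1988) 1019–1030,
  eqs. (15)–(25), pp. 1027–1029.
* [DysonLiebSimon1978] F. J. Dyson, E. H. Lieb, B. Simon, J. Stat. Phys. 18 (1978) 335–383, §2, §4.
-/

noncomputable section

open Matrix Finset Filter Topology
open scoped ComplexOrder Kronecker
open Literature.MathematicalPhysics.QuantumLattice Literature.MathematicalPhysics.QuantumLattice.SpinOperators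
  Literature.Probability.LatticeModels

namespace Literature.MathematicalPhysics.QuantumLattice

variable {d : ℕ}

/-! ### The sublattice rotation: `H(h)` is unitarily equivalent to `H♭(h)` -/

section Rotation

variable (k : ℕ) [NeZero (2 * k)] (n : ℕ)

/-- The Néel sign as the parity through `ℤ/2ℤ`: `(-1)^{Σᵢ xᵢ} = ±1` according to the class of
`Σᵢ xᵢ` modulo `2`. [folklore] -/
theorem neelSign_eq_ite (x : TorusSite d (2 * k)) :
    (neelSign x : ℂ) =
      if (∑ j, ZMod.castHom (dvd_mul_right 2 k) (ZMod 2) (x j)) = 0 then 1 else -1 := by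
  have hcast : (∑ j, ZMod.castHom (dvd_mul_right 2 k) (ZMod 2) (x j)) =
      ((∑ j, (x j).val : ℕ) : ZMod 2) := by
    rw [Nat.cast_sum]
    refine sum_congr rfl fun j _ => ?_
    rw [ZMod.castHom_apply, ZMod.cast_eq_val]
  rw [hcast, neelSign]
  by_cases h : Even (∑ j, (x j).val)
  · rw [if_pos (ZMod.natCast_eq_zero_iff_even.2 h)]
    push_cast
    exact h.neg_one_pow
  · rw [if_neg (fun h' => h (ZMod.natCast_eq_zero_iff_even.1 h'))]
    push_cast
    exact (Nat.not_even_iff_odd.1 h).neg_one_pow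

/-- **The staggered field Hamiltonian as a sum over bonds** (`L = 2k ≥ 3`):
`H(h) = Σ_{⟨xy⟩} [b⁰ + b¹ + b² - (h_x - h_y)(S̃¹_x - S̃¹_y) + ½(h_x - h_y)²]`.
[Kennedy–Lieb–Shastry, J. Stat. Phys. 53 (1988), eq. (17), original frame] [folklore] -/
theorem heisFieldHamiltonian_eq_edgeSum (hL : 3 ≤ 2 * k) (h : TorusSite d (2 * k) → ℝ) :
    heisFieldHamiltonian (2 * k) n h = ∑ e ∈ (torusGraph d (2 * k)).edgeFinset,
      Sym2.lift ⟨fun x y => spinBond n 0 x y + spinBond n 1 x y + spinBond n 2 x y -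
        ((h x - h y : ℝ) : ℂ) • (stagSiteSpinX (2 * k) n x - stagSiteSpinX (2 * k) n y) +
        (((h x - h y) ^ 2 / 2 : ℝ) : ℂ) • (1 : Op (TorusSite d (2 * k)) (n + 1)), fun x y => by
          simp only [spinBond_comm n _ x y]
          congr 2
          · rw [← neg_sub (h y) (h x), Complex.ofReal_neg, neg_smul, ← smul_neg, neg_sub]
          · rw [← neg_sub (h y) (h x), neg_sq]⟩ e := by
  have hV : heisStagGradField (2 * k) n h = ∑ e ∈ (torusGraph d (2 * k)).edgeFinset,
      Sym2.lift ⟨fun x y => ((h x - h y : ℝ) : ℂ) • (stagSiteSpinX (2 * k) n x - stagSiteSpinX (2 * k) n y),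
        fun x y => by
          dsimp only
          rw [← neg_sub (h y) (h x), Complex.ofReal_neg, neg_smul, ← smul_neg, neg_sub]⟩ e := by
    rw [heisStagGradField, ← sum_pairs_eq_sum_edgeFinset' (2 * k) hL]
    rfl
  have hQ : (((xyFieldEnergy (2 * k) h / 2 : ℝ) : ℂ) • (1 : Op (TorusSite d (2 * k)) (n + 1))) =
      ∑ e ∈ (torusGraph d (2 * k)).edgeFinset,
        Sym2.lift ⟨fun x y => (((h x - h y) ^ 2 / 2 : ℝ) : ℂ) • (1 : Op (TorusSite d (2 * k)) (n + 1)),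
          fun x y => by dsimp only; rw [← neg_sub (h y) (h x), neg_sq]⟩ e := by
    rw [xyFieldEnergy, sum_div, Complex.ofReal_sum, sum_smul]
    simp_rw [sum_div, Complex.ofReal_sum, sum_smul]
    rw [← sum_pairs_eq_sum_edgeFinset' (2 * k) hL]
    rfl
  rw [heisFieldHamiltonian, heisenbergTorus_one_eq_sum, hV, hQ, ← sum_sub_distrib, ← sum_add_distrib]
  refine sum_congr rfl fun e he => ?_
  revert he
  refine Sym2.ind (fun x y => ?_) e
  intro he
  have hxy : x ≠ y := ne_of_mk_mem_edgeFinset he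
  simp only [Sym2.lift_mk, spinDotSym_mk, spinDot, Fin.sum_univ_three]

/-- **The sublattice rotation** (Kennedy–Lieb–Shastry, J. Stat. Phys. 53 (1988), eqs. (15)–(16);
Dyson–Lieb–Simon 1978, §2): on the even torus, the rotation by `π` about the `2`-axis on the odd
sublattice maps `H(h)` to `H♭(h)` (`S¹ ↦ ∓S¹`, `S³ ↦ ∓S³`, `S² ↦ S²`, and the staggered `S̃¹ ↦ S¹`);
in particular they have the same ground-state energy. [cite: KLS1988JSP, eqs. (15)–(17)] -/
theorem groundEnergy_heisFieldHamiltonian_eq (hL3 : 3 ≤ 2 * k) (h : TorusSite d (2 * k) → ℝ) :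
    (heisFieldHamiltonian (2 * k) n h).groundEnergy = (dlsField (2 * k) n h).groundEnergy := by
  set E := (torusGraph d (2 * k)).edgeFinset with hE
  -- the single-site rotation `R₂ = V²` (`π` about the `2`-axis): `Sˣ ↦ -Sˣ`, `Sʸ ↦ Sʸ`, `Sᶻ ↦ -Sᶻ`
  obtain ⟨V, hV, hV', hVz, hVx, hVy⟩ := exists_unitary_conj_spinZ_eq_spinX n
  set R := V * V with hR
  have hRR : R * Rᴴ = 1 := by
    rw [hR, conjTranspose_mul, Matrix.mul_assoc, ← Matrix.mul_assoc V Vᴴ, hV, Matrix.one_mul, hV]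
  have hRR' : Rᴴ * R = 1 := by
    rw [hR, conjTranspose_mul, Matrix.mul_assoc, ← Matrix.mul_assoc Vᴴ V, hV', Matrix.one_mul, hV']
  have hRz : R * SpinOperators.spinZ n * Rᴴ = -SpinOperators.spinZ n := by
    rw [hR, conjTranspose_mul, show V * V * SpinOperators.spinZ n * (Vᴴ * Vᴴ) =
      V * (V * SpinOperators.spinZ n * Vᴴ) * Vᴴ by simp only [Matrix.mul_assoc], hVz, hVx]
  have hRy : R * spinY n * Rᴴ = spinY n := by
    rw [hR, conjTranspose_mul, show V * V * spinY n * (Vᴴ * Vᴴ) =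
      V * (V * spinY n * Vᴴ) * Vᴴ by simp only [Matrix.mul_assoc], hVy, hVy]
  have hRx : R * spinX n * Rᴴ = -spinX n := by
    rw [hR, conjTranspose_mul, show V * V * spinX n * (Vᴴ * Vᴴ) =
      V * (V * spinX n * Vᴴ) * Vᴴ by simp only [Matrix.mul_assoc], hVx, Matrix.mul_neg,
      Matrix.neg_mul, hVz]
  -- the product unitary on the odd sublattice
  set ε : TorusSite d (2 * k) → ZMod 2 := fun x =>
    ∑ j, ZMod.castHom (dvd_mul_right 2 k) (ZMod 2) (x j) with hε
  set u : TorusSite d (2 * k) → Matrix (Fin (n + 1)) (Fin (n + 1)) ℂ :=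
    fun z => if ε z = 0 then 1 else R with hu
  have hua : ∀ z, u z * (u z)ᴴ = 1 := by
    intro z; simp only [hu]; split_ifs
    · rw [conjTranspose_one, Matrix.mul_one]
    · exact hRR
  have hub : ∀ z, (u z)ᴴ * u z = 1 := by
    intro z; simp only [hu]; split_ifs
    · rw [conjTranspose_one, Matrix.mul_one]
    · exact hRR'
  set sgn : TorusSite d (2 * k) → ℂ := fun z => if ε z = 0 then 1 else -1 with hsgn
  have hsgnN : ∀ z, (neelSign z : ℂ) = sgn z := fun z => neelSign_eq_ite k z
  have hsgn2 : ∀ z, sgn z * sgn z = 1 := by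
    intro z; simp only [hsgn]; split_ifs <;> norm_num
  have hux : ∀ z, u z * spinX n * (u z)ᴴ = sgn z • spinX n := by
    intro z; simp only [hu, hsgn]; split_ifs
    · rw [conjTranspose_one, Matrix.mul_one, Matrix.one_mul, one_smul]
    · rw [hRx, neg_one_smul]
  have huy : ∀ z, u z * spinY n * (u z)ᴴ = spinY n := by
    intro z; simp only [hu]; split_ifs
    · rw [conjTranspose_one, Matrix.mul_one, Matrix.one_mul]
    · exact hRy
  have huz : ∀ z, u z * SpinOperators.spinZ n * (u z)ᴴ = sgn z • SpinOperators.spinZ n := by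
    intro z; simp only [hu, hsgn]; split_ifs
    · rw [conjTranspose_one, Matrix.mul_one, Matrix.one_mul, one_smul]
    · rw [hRz, neg_one_smul]
  have hedge : ∀ e ∈ E, ∀ x y, e = s(x, y) → sgn x * sgn y = -1 := by
    intro e he x y hexy
    subst hexy
    rw [hE, SimpleGraph.mem_edgeFinset, SimpleGraph.mem_edgeSet, torusGraph_adj_iff] at he
    have h01 : ∀ t : ZMod 2, t = 0 ∨ t = 1 := by decide
    have key : ∀ x' : TorusSite d (2 * k), ∀ i, sgn x' * sgn (x' + Pi.single i 1) = -1 := by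
      intro x' i
      have hpar : ε (x' + Pi.single i 1) = ε x' + 1 := torusParity_add_single k x' i
      simp only [hsgn, hpar]
      rcases h01 (ε x') with h0 | h1
      · rw [if_pos h0, if_neg (by rw [h0]; decide), one_mul]
      · rw [if_neg (by rw [h1]; decide), if_pos (by rw [h1]; decide), mul_one]
    obtain ⟨-, ⟨i, rfl⟩ | ⟨i, rfl⟩⟩ := he
    · exact key x i
    · rw [mul_comm]; exact key y i
  set W := productOp u with hW
  -- conjugation of the atoms
  have hWs : ∀ x : TorusSite d (2 * k), W * stagSiteSpinX (2 * k) n x * Wᴴ = siteSpin n x 0 := by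
    intro x
    rw [stagSiteSpinX, Matrix.mul_smul, Matrix.smul_mul, hW, productOp_conj_siteSpin hua, spinVec_zero,
      hux, onSite_smul', smul_smul, hsgnN, hsgn2, one_smul]
    rfl
  have hb0 : ∀ x y : TorusSite d (2 * k), sgn x * sgn y = -1 →
      W * spinBond n 0 x y * Wᴴ = -spinBond n 0 x y := by
    intro x y hxy
    rw [hW, productOp_conj_spinBond hua hub, spinVec_zero, hux, hux, onSite_smul', onSite_smul',
      smul_mul_smul_comm, smul_mul_smul_comm, mul_comm (sgn y) (sgn x), hxy, spinBond]
    simp only [neg_smul, one_smul]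
    rw [← neg_add, smul_neg]
    rfl
  have hb1 : ∀ x y : TorusSite d (2 * k), W * spinBond n 1 x y * Wᴴ = spinBond n 1 x y := by
    intro x y
    rw [hW, productOp_conj_spinBond hua hub, spinVec_one, huy, huy, spinBond]
    rfl
  have hb2 : ∀ x y : TorusSite d (2 * k), sgn x * sgn y = -1 →
      W * spinBond n 2 x y * Wᴴ = -spinBond n 2 x y := by
    intro x y hxy
    rw [hW, productOp_conj_spinBond hua hub, spinVec_two, huz, huz, onSite_smul', onSite_smul',
      smul_mul_smul_comm, smul_mul_smul_comm, mul_comm (sgn y) (sgn x), hxy, spinBond]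
    simp only [neg_smul, one_smul]
    rw [← neg_add, smul_neg]
    rfl
  have hW1 : W * (1 : Op (TorusSite d (2 * k)) (n + 1)) * Wᴴ = 1 := by
    rw [Matrix.mul_one, hW, productOp_mul_conjTranspose hua]
  have hHW : W * heisFieldHamiltonian (2 * k) n h * Wᴴ = dlsField (2 * k) n h := by
    rw [heisFieldHamiltonian_eq_edgeSum k n hL3, dlsField, xyRealFieldHamiltonian, torusZZBondSum,
      ← hE, ← sum_sub_distrib, Finset.mul_sum, Finset.sum_mul]
    refine sum_congr rfl fun e he => ?_
    induction e using Sym2.ind with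
    | h x y =>
      have hs := hedge _ he x y rfl
      simp only [Sym2.lift_mk, xyRealBond, Matrix.mul_add, Matrix.add_mul,
        Matrix.mul_sub, Matrix.sub_mul, Matrix.mul_smul, Matrix.smul_mul, hb0 x y hs, hb1,
        hb2 x y hs, hW1, hWs]
      abel
  have hU : W ∈ Matrix.unitaryGroup (TensorIndex (TorusSite d (2 * k)) (n + 1)) ℂ :=
    Matrix.mem_unitaryGroup_iff.2 (by rw [hW]; exact productOp_mul_conjTranspose hua)
  rw [← hHW, Matrix.groundEnergy_unitary_conj hU]

end Rotation

/-! ### Reflection positivity and the descent -/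

section Descent

variable (k : ℕ) [NeZero (2 * k)] (j : Fin d) (a : ZMod (2 * k)) (n : ℕ)

/-- **The reflection inequality for the ground-state energy of the antiferromagnet**
(Kennedy–Lieb–Shastry, J. Stat. Phys. 53 (1988), the display after eq. (25)): on the even torus of
side `2k ≥ 4` and for every pair of planes, `½E(h^L) + ½E(h^R) ≤ E(h)`.
[cite: KLS1988JSP, eqs. (20)–(25)] -/
theorem heis_groundEnergy_reflect_le (hL3 : 3 ≤ 2 * k) (h : TorusSite d (2 * k) → ℝ) :
    ((heisFieldHamiltonian (2 * k) n (reflectFieldLeft (2 * k) j a h)).groundEnergy +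
        (heisFieldHamiltonian (2 * k) n (reflectFieldRight (2 * k) j a h)).groundEnergy) / 2 ≤
      (heisFieldHamiltonian (2 * k) n h).groundEnergy := by
  have hL : Even (2 * k) := even_two_mul k
  rw [groundEnergy_heisFieldHamiltonian_eq k n hL3, groundEnergy_heisFieldHamiltonian_eq k n hL3,
    groundEnergy_heisFieldHamiltonian_eq k n hL3]
  set A := xyLeftHamiltonian (2 * k) j a hL n h - torusZZLeft (2 * k) j a hL n with hA
  set B := xyLeftHamiltonian (2 * k) j a hL n (fun y => h (Torus.reflectBetweenSites j a y)) -
    torusZZLeft (2 * k) j a hL n with hB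
  set M : torusCrossSites (2 * k) j a × Bool ⊕ torusCrossSites (2 * k) j a →
      Op (torusLeftHalf (2 * k) j a) (n + 1) :=
    Sum.elim (xyCrossOp (2 * k) j a hL n h) (torusZZCrossOp (2 * k) j a hL n) with hM
  set N : torusCrossSites (2 * k) j a × Bool ⊕ torusCrossSites (2 * k) j a →
      Op (torusLeftHalf (2 * k) j a) (n + 1) :=
    Sum.elim (xyCrossOp (2 * k) j a hL n (fun y => h (Torus.reflectBetweenSites j a y)))
      (torusZZCrossOp (2 * k) j a hL n) with hN
  set e := torusSplit (q := n + 1) (2 * k) j a hL with he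
  have hK : dlsField (2 * k) n h = (A ⊗ₖ 1 + 1 ⊗ₖ B - ∑ i, M i ⊗ₖ N i).submatrix e e :=
    dlsField_eq_submatrix (2 * k) j a hL n h
  have hKL : dlsField (2 * k) n (reflectFieldLeft (2 * k) j a h) =
      (A ⊗ₖ 1 + 1 ⊗ₖ A - ∑ i, M i ⊗ₖ M i).submatrix e e := by
    rw [dlsField_eq_submatrix (2 * k) j a hL n,
      xyLeftHamiltonian_congr (2 * k) j a n hL (fun x hx => reflectFieldLeft_of_mem (2 * k) j a h hx),
      xyLeftHamiltonian_congr (2 * k) j a n hL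
        (fun x hx => reflectFieldLeft_reflectBetweenSites_of_mem (2 * k) j a hL h hx),
      xyCrossOp_congr (2 * k) j a n hL (fun x hx => reflectFieldLeft_of_mem (2 * k) j a h hx),
      xyCrossOp_congr (2 * k) j a n hL
        (fun x hx => reflectFieldLeft_reflectBetweenSites_of_mem (2 * k) j a hL h hx)]
  have hKR : dlsField (2 * k) n (reflectFieldRight (2 * k) j a h) =
      (B ⊗ₖ 1 + 1 ⊗ₖ B - ∑ i, N i ⊗ₖ N i).submatrix e e := by
    rw [dlsField_eq_submatrix (2 * k) j a hL n,
      xyLeftHamiltonian_congr (2 * k) j a n hL (fun x hx => reflectFieldRight_of_mem (2 * k) j a h hx),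
      xyLeftHamiltonian_congr (2 * k) j a n hL
        (h₁ := fun y => reflectFieldRight (2 * k) j a h (Torus.reflectBetweenSites j a y))
        (fun x hx => reflectFieldRight_reflectBetweenSites_of_mem (2 * k) j a hL h hx),
      xyCrossOp_congr (2 * k) j a n hL (fun x hx => reflectFieldRight_of_mem (2 * k) j a h hx),
      xyCrossOp_congr (2 * k) j a n hL
        (h₁ := fun y => reflectFieldRight (2 * k) j a h (Torus.reflectBetweenSites j a y))
        (fun x hx => reflectFieldRight_reflectBetweenSites_of_mem (2 * k) j a hL h hx)]
  have herm : ∀ (f : TorusSite d (2 * k) → ℝ) (K : Matrix _ _ ℂ),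
      dlsField (2 * k) n f = K.submatrix e e → K.IsHermitian := by
    intro f K hf
    have : K = (dlsField (2 * k) n f).submatrix e.symm e.symm := by
      rw [hf, submatrix_submatrix, Equiv.self_comp_symm, submatrix_id_id]
    rw [this]
    exact (dlsField_isHermitian (2 * k) n f).submatrix _
  haveI : Nonempty ((torusLeftHalf (2 * k) j a → Fin (n + 1)) ×
      (torusLeftHalf (2 * k) j a → Fin (n + 1))) := ⟨(fun _ => 0, fun _ => 0)⟩
  have hAt : Aᵀ = A := by
    rw [hA, dlsLeft_transpose_eq,
      ((xyLeftHamiltonian_isHermitian (2 * k) j a n hL h).sub (torusZZLeft_isHermitian (2 * k) j a hL n)).eq]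
  have hBt : Bᵀ = B := by
    rw [hB, dlsLeft_transpose_eq,
      ((xyLeftHamiltonian_isHermitian (2 * k) j a n hL _).sub (torusZZLeft_isHermitian (2 * k) j a hL n)).eq]
  have hRP := Matrix.kls_groundEnergy_reflection A B M N hAt hBt
    (fun i => dlsCrossOp_transpose_eq (2 * k) j a hL n h i)
    (fun i => dlsCrossOp_transpose_eq (2 * k) j a hL n _ i) (herm _ _ hK) (herm _ _ hKL) (herm _ _ hKR)
  rw [hK, hKL, hKR, Matrix.groundEnergy_submatrix_equiv (herm _ _ hK),
    Matrix.groundEnergy_submatrix_equiv (herm _ _ hKL),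
    Matrix.groundEnergy_submatrix_equiv (herm _ _ hKR)]
  exact hRP

/-- **No bad bonds ⇒ `H(h) = H`** for the staggered field Hamiltonian. [Kennedy–Lieb–Shastry,
J. Stat. Phys. 53 (1988), p. 1027] [folklore] -/
theorem heisFieldHamiltonian_eq_of_badBondCount_eq_zero (hL2 : 2 ≤ 2 * k)
    {h : TorusSite d (2 * k) → ℝ} (h0 : badBondCount (2 * k) h = 0) :
    heisFieldHamiltonian (2 * k) n h = heisenbergTorus d (2 * k) n 1 := by
  classical
  have hgood : ∀ (x : TorusSite d (2 * k)) (i : Fin d), h x - h (x + Pi.single i 1) = 0 := by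
    intro x i
    rw [badBondCount, Finset.card_eq_zero, Finset.filter_eq_empty_iff] at h0
    have he : s(x, x + Pi.single i 1) ∈ (torusGraph d (2 * k)).edgeFinset := by
      rw [SimpleGraph.mem_edgeFinset, SimpleGraph.mem_edgeSet]
      exact torusGraph_adj_add_single (2 * k) hL2 x i
    have h1 := h0 he
    rw [not_not, Sym2.map_mk, Sym2.mk_isDiag_iff] at h1
    rw [h1, sub_self]
  have hV : heisStagGradField (2 * k) n h = 0 := by
    unfold heisStagGradField
    exact sum_eq_zero fun x _ => sum_eq_zero fun i _ => by
      rw [hgood x i, Complex.ofReal_zero, zero_smul]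
  have hQ : xyFieldEnergy (2 * k) h = 0 := by
    unfold xyFieldEnergy
    exact sum_eq_zero fun x _ => sum_eq_zero fun i _ => by rw [hgood x i]; ring
  rw [heisFieldHamiltonian, hV, hQ, sub_zero, zero_div, Complex.ofReal_zero, zero_smul, add_zero]

/-- **Ground-state Gaussian domination for the antiferromagnet** (Kennedy–Lieb–Shastry, J. Stat.
Phys. 53 (1988), eq. (18)): on even tori of side `2k ≥ 4`, for all `d`, all spins and all real
fields `g`, `E₀(H) ≤ E₀(H(g))`. Proof as printed (pp. 1027–1029): minimise `E(f) = E₀(H(f))` over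
the finitely many fields with values in the range of `g`, then the number of bad bonds; a bad bond
would give planes with `½E(f^L) + ½E(f^R) ≤ E(f)` (`heis_groundEnergy_reflect_le`) and one of
`f^L`, `f^R` has fewer bad bonds (`badBondCount_reflect`); so the minimiser is constant on bonds
and `H(f) = H`. [cite: KLS1988JSP, eq. (18), pp. 1027–1029] -/
theorem heis_gaussianDomination_ground (L : ℕ) [NeZero L] (hL : Even L) (h4 : 4 ≤ L)
    (g : TorusSite d L → ℝ) :
    (heisenbergTorus d L n 1).groundEnergy ≤ (heisFieldHamiltonian L n g).groundEnergy := by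
  classical
  obtain ⟨k', rfl⟩ : ∃ k', L = 2 * k' := ⟨L / 2, by obtain ⟨k', hk'⟩ := hL; omega⟩
  have hL3 : 3 ≤ 2 * k' := by omega
  have hL2 : 2 ≤ 2 * k' := by omega
  set V : Finset ℝ := (univ : Finset (TorusSite d (2 * k'))).image g with hV
  set Ef : (TorusSite d (2 * k') → V) → ℝ := fun f =>
    (heisFieldHamiltonian (2 * k') n (fun x => (f x : ℝ))).groundEnergy with hEf
  set Nf : (TorusSite d (2 * k') → V) → ℕ := fun f => badBondCount (2 * k') (fun x => (f x : ℝ)) with hNf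
  set g' : TorusSite d (2 * k') → V := fun x => ⟨g x, mem_image_of_mem g (mem_univ x)⟩ with hg'
  haveI : Nonempty (TorusSite d (2 * k') → V) := ⟨g'⟩
  obtain ⟨f₀, hf₀⟩ := Finite.exists_min Ef
  set S : Finset (TorusSite d (2 * k') → V) := univ.filter fun f => Ef f = Ef f₀ with hS
  obtain ⟨f₁, hf₁S, hf₁min⟩ := S.exists_min_image Nf ⟨f₀, by simp [hS]⟩
  have hEf₁ : Ef f₁ = Ef f₀ := (mem_filter.1 hf₁S).2
  have hN0 : Nf f₁ = 0 := by
    by_contra hN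
    obtain ⟨x₀, i, hbad⟩ : ∃ (x₀ : TorusSite d (2 * k')) (i : Fin d),
        (f₁ x₀ : ℝ) ≠ f₁ (x₀ + Pi.single i 1) := by
      obtain ⟨e, he⟩ := Finset.card_ne_zero.1 hN
      obtain ⟨heE, hbe⟩ := mem_filter.1 he
      revert heE hbe
      refine Sym2.ind (fun u v => ?_) e
      intro heE hbe
      rw [SimpleGraph.mem_edgeFinset, SimpleGraph.mem_edgeSet, torusGraph_adj_iff] at heE
      rw [Sym2.map_mk, Sym2.mk_isDiag_iff] at hbe
      obtain ⟨-, ⟨i, rfl⟩ | ⟨i, rfl⟩⟩ := heE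
      · exact ⟨u, i, hbe⟩
      · exact ⟨v, i, fun h' => hbe h'.symm⟩
    set j' := i
    obtain ⟨hxCS, hθx⟩ := add_single_mem_torusCrossSites (2 * k') hL2 j' x₀
    set a' : ZMod (2 * k') := x₀ j' with ha'
    set φ : TorusSite d (2 * k') → ℝ := fun x => (f₁ x : ℝ) with hφ
    set fL : TorusSite d (2 * k') → V := fun y =>
      if y ∈ torusLeftHalf (2 * k') j' a' then f₁ y else f₁ (Torus.reflectBetweenSites j' a' y) with hfL
    set fR : TorusSite d (2 * k') → V := fun y =>
      if y ∈ torusLeftHalf (2 * k') j' a' then f₁ (Torus.reflectBetweenSites j' a' y) else f₁ y with hfR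
    have hfLφ : (fun x => (fL x : ℝ)) = reflectFieldLeft (2 * k') j' a' φ := by
      funext y
      simp only [hfL, reflectFieldLeft, hφ]
      split_ifs <;> rfl
    have hfRφ : (fun x => (fR x : ℝ)) = reflectFieldRight (2 * k') j' a' φ := by
      funext y
      simp only [hfR, reflectFieldRight, hφ]
      split_ifs <;> rfl
    have hRP := heis_groundEnergy_reflect_le k' j' a' n hL3 φ
    have hEL : Ef fL = (heisFieldHamiltonian (2 * k') n (reflectFieldLeft (2 * k') j' a' φ)).groundEnergy := by
      simp only [hEf, hfLφ]
    have hER : Ef fR = (heisFieldHamiltonian (2 * k') n (reflectFieldRight (2 * k') j' a' φ)).groundEnergy := by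
      simp only [hEf, hfRφ]
    have hE1 : Ef f₁ = (heisFieldHamiltonian (2 * k') n φ).groundEnergy := by simp only [hEf, hφ]
    have h1 := hf₀ fL
    have h2 := hf₀ fR
    rw [← hEL, ← hER, ← hE1, hEf₁] at hRP
    have hELm : Ef fL = Ef f₀ := by linarith
    have hERm : Ef fR = Ef f₀ := by linarith
    have hNL : Nf f₁ ≤ Nf fL := hf₁min fL (by simp [hS, hELm])
    have hNR : Nf f₁ ≤ Nf fR := hf₁min fR (by simp [hS, hERm])
    have hcount := badBondCount_reflect (2 * k') j' a' hL φ
    have hNLφ : Nf fL = badBondCount (2 * k') (reflectFieldLeft (2 * k') j' a' φ) := by simp only [hNf, hfLφ]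
    have hNRφ : Nf fR = badBondCount (2 * k') (reflectFieldRight (2 * k') j' a' φ) := by simp only [hNf, hfRφ]
    have hN1φ : Nf f₁ = badBondCount (2 * k') φ := by simp only [hNf, hφ]
    have hC : 1 ≤ ∑ x ∈ torusCrossSites (2 * k') j' a',
        (if (Sym2.map φ s(x, Torus.reflectBetweenSites j' a' x)).IsDiag then 0 else 1) := by
      have hone : (if (Sym2.map φ s(x₀ + Pi.single j' 1,
          Torus.reflectBetweenSites j' a' (x₀ + Pi.single j' 1))).IsDiag then 0 else 1) = 1 := by
        simp only [hθx, Sym2.map_mk, Sym2.mk_isDiag_iff]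
        rw [if_neg]
        exact fun h' => hbad h'.symm
      calc 1 = (if (Sym2.map φ s(x₀ + Pi.single j' 1,
          Torus.reflectBetweenSites j' a' (x₀ + Pi.single j' 1))).IsDiag then 0 else 1) := hone.symm
        _ ≤ _ := Finset.single_le_sum (f := fun x =>
          if (Sym2.map φ s(x, Torus.reflectBetweenSites j' a' x)).IsDiag then 0 else 1)
          (fun _ _ => Nat.zero_le _) hxCS
    rw [← hNLφ, ← hNRφ, ← hN1φ] at hcount
    omega
  have hH : heisFieldHamiltonian (2 * k') n (fun x => (f₁ x : ℝ)) = heisenbergTorus d (2 * k') n 1 :=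
    heisFieldHamiltonian_eq_of_badBondCount_eq_zero k' n hL2 hN0
  have hEg : Ef g' = (heisFieldHamiltonian (2 * k') n g).groundEnergy := by simp only [hEf, hg']
  have h1 : Ef f₁ = (heisenbergTorus d (2 * k') n 1).groundEnergy := by simp only [hEf, hH]
  rw [← hEg, ← h1, hEf₁]
  exact hf₀ g'

end Descent

/-! ### Corollaries: the infrared bound (A), and the theorem from the `d = 3` numerics -/

/-- **The `T = 0` infrared bound (A) for the antiferromagnet**, unconditionally: for `d ≥ 1`,
every spin, every even side `2k ≥ 4` and every `q ≠ Q`, `0 ≤ ĝ_q` and `ĝ_q² E_{q-Q} ≤ (-ε/2) E_q`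
(Kennedy–Lieb–Shastry, J. Stat. Phys. 53 (1988), eq. (1) with `e₀ = -3dε`).
[cite: KLS1988JSP, eqs. (1), (12)–(19)] -/
theorem heis_infraredBound (hd : 0 < d) (n k : ℕ) (hk : 2 ≤ k) (q : TorusSite d (2 * k))
    (hq : q ≠ neelIndex (2 * k)) :
    0 ≤ heisStructureFactor 0 (2 * k) n q ∧
      heisStructureFactor 0 (2 * k) n q ^ 2 *
          dispersion (latticeMomentum (2 * k) (q - neelIndex (2 * k))) ≤
        (-heisBondCorr (d := d) 0 (2 * k) n / 2) * dispersion (latticeMomentum (2 * k) q) := by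
  haveI : NeZero (2 * k) := ⟨by omega⟩
  exact heis_infraredBound_of_groundEnergy_le hd n k hk
    (fun h => heis_gaussianDomination_ground n (2 * k) (even_two_mul k) (by omega) h) q hq

/-- **Kennedy–Lieb–Shastry / Dyson–Lieb–Simon, up to the `d = 3` numerical input.** If the
punctured Riemann sums of the KLS lattice integrand in three dimensions satisfy
`R_L(3) ≤ ρ < 1/√6` for all large `L` (KLS p. 1022: `∫ d³q (E_q/E_{q-Q})^{1/2} ⅓(-Σcos qᵢ)₊ = 0.35`),
then `kennedy_lieb_shastry_ground` holds: Gaussian domination (this file) ⇒ the infrared bound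
(A) (`HeisenbergOrderNeelInfrared.lean`) ⇒ Néel order (`HeisenbergOrderNeelAssembly.lean`); the
cases of spin `S ≥ 1` (`d ∈ {2, 3}`) do not use the hypothesis.
[cite: KLS1988JSP, Theorem (p. 1022), pp. 1020–1029] -/
theorem kennedy_lieb_shastry_ground_of_riemannSum_three
    (hR : ∃ ρ : ℝ, ρ < 1 / Real.sqrt 6 ∧ ∀ᶠ L : ℕ in atTop, klsRiemannSum 3 L ≤ ρ) :
    kennedy_lieb_shastry_ground :=
  kennedy_lieb_shastry_ground_of_infraredBound
    (fun _d hd n _hn k hk q hq => heis_infraredBound (by omega) n k hk q hq) hR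

end Literature.MathematicalPhysics.QuantumLattice
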